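import Mathlib
import HarnessLib
import Summits.ValiantsHypothesis.ValiantsHypothesis.Theorems.LacunarySymmetroidMatrixDescartesProductPlusOneSlopeKnee
import Summits.ValiantsHypothesis.ValiantsHypothesis.Theorems.LacunarySymmetroidMatrixDescartesProductPlusOneSlopeLine

/-!
# LINE (A) `product_plus_one`, floor in W-currency: the COHERENT cell — a `(+,+,−)` row's rising phase is an initial segment, and one rising
# coherent row against an incoherent cloud carries ≤ 2 zeros of `W(∏ f)` (≤ 3 of `eulerNumerator d a l₀`, every coupling)

✓ `…SlopeKnee` (`oneCoherent_slope_no_three_zeros`) counts the cell abstractly under the hypothesis «the coherent row's slope is rising on the whole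
window».  Here the hypothesis is reduced to its value at the RIGHT end of the window, and the cell is stated in the line's currency — the first
window of the card's «T4 + T5 at ratio > 4» core (one coherent row among incoherent rows, before the first zero, while the coherent row still rises).

Normal form of an unswitched coherent row: `A − Bx^p − Cx^q` with `A > 0`, `B < 0 < C`, `u = (A − Bx^p − Cx^q)⁻¹ > 0`; its Euler ratio `φ = −H₁u` rises
(b-knee, `H₁ < 0`), turns, and then pulls to `−∞` at the row's zero; slope form `ψ₁` (`s = θφ = −ψ₁`).
* `coherent_rowPsi1_pos_of_rowH1_nonneg` — `H₁ ≥ 0 ⇒ ψ₁ > 0`: the rising phase lies inside `{H₁ < 0}` (`H₂ − pH₁ = q(q−p)γ > 0`);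
* `coherent_rowH1_neg_of_le` — `H₁/x^p = pB + qC x^{q−p}` increases, so `H₁(x₂) < 0 ⇒ H₁ < 0` on `(0, x₂]`;
* `coherent_value_pos_of_le` — `F/x^q = A x^{−q} + |B| x^{p−q} − C` decreases: unswitched at `x₂` ⇒ unswitched on `(0, x₂]`;
* ★ `coherent_rising_persist` — rising at the right end (`ψ₁(x₂) < 0`) ⇒ rising on `[x₁, x₂]`: `M = −ψ₁/(H₁u²)` is strictly increasing on `{H₁ < 0}`
  (`dM/dx = −(H₁H₃ − H₂²)/(H₁²·u·x) > 0`, since `H₁H₃ − H₂² = βγpq(q−p)² < 0` for `β < 0 < γ`);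
* ★★ `oneCoherent_trinomialCloud_wronskian_no_three_zeros` / ★ `…_wronskian_roots_le_two` / ★★ `…_eulerNumerator_roots_le_three` — LINE currency
  (K = 3, `d 0 < d 1 < d 2`): row `j₀` coherent (`a_{j₀0} > 0`, `a_{j₀1} > 0`, `a_{j₀2} < 0`), every other row an incoherent puller; on a window
  `⊂ (0,∞)` at whose right end every row is unswitched and the coherent row still rises (`rowPsi1 e₁ e₂ a_{j₀0} (−a_{j₀1}) (−a_{j₀2}) < 0` there):
  `W(∏_j f_j)` has no three zeros / ≤ 2 zeros, and `eulerNumerator d a l₀` has ≤ 3 zeros for EVERY coupling `l₀`.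

HONEST FRAMING: one cell (one coherent row, rising phase, incoherent company); the coherent row's PULLING phase against switched incoherent risers
(the ratio-> 4 interaction proper), several humps, `OneChangeFloorK3` / `WronskianBudgetK3` / the stubs / `MatrixDescartes` OPEN; `VP ≠ VNP` NOT proved.
No definitions, no named facts.
-/

set_option linter.dupNamespace false

namespace Summit.ValiantsHypothesis.ValiantsHypothesis.Theorems.LacunarySymmetroidMatrixDescartes

namespace ProductPlusOne

open Finset Polynomial
open scoped BigOperators Polynomial

/-! ### §1 The coherent row: where it rises -/

section Row

variable (e₁ e₂ : ℕ) (A B C : ℝ)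

/-- `H₁ ≥ 0 ⇒ ψ₁ > 0` for an unswitched row with `C > 0` (`H₂ = pH₁ + q(q−p)·Cx^q`): the rising phase (`ψ₁ < 0`) lies inside `{H₁ < 0}`. [this file's lemma] -/
theorem coherent_rowPsi1_pos_of_rowH1_nonneg {x : ℝ} (hx : 0 < x) (hC : 0 < C)
    (hF : 0 < A - B * x ^ (e₁ + 1) - C * x ^ (e₁ + e₂ + 2)) (hH1 : 0 ≤ rowH e₁ e₂ 1 B C x) :
    0 < rowPsi1 e₁ e₂ A B C x := by
  have hu := rowU_pos e₁ e₂ A B C hF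
  have hid : rowH e₁ e₂ 2 B C x = ((e₁ : ℝ) + 1) * rowH e₁ e₂ 1 B C x
      + ((e₁ : ℝ) + e₂ + 2) * ((e₂ : ℝ) + 1) * C * x ^ (e₁ + e₂ + 2) := by unfold rowH; ring
  have hH2 : 0 < rowH e₁ e₂ 2 B C x := by
    rw [hid]
    have : 0 < ((e₁ : ℝ) + e₂ + 2) * ((e₂ : ℝ) + 1) * C * x ^ (e₁ + e₂ + 2) := by positivity
    have : 0 ≤ ((e₁ : ℝ) + 1) * rowH e₁ e₂ 1 B C x := by positivity
    linarith
  unfold rowPsi1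
  have : 0 ≤ rowH e₁ e₂ 1 B C x ^ 2 * rowU e₁ e₂ A B C x ^ 2 := by positivity
  nlinarith [mul_pos hH2 hu]

/-- `H₁/x^p` is non-decreasing (`C ≥ 0`): `H₁(x₂) < 0`, `0 < x ≤ x₂ ⇒ H₁(x) < 0`. [this file's lemma] -/
theorem coherent_rowH1_neg_of_le (hC : 0 ≤ C) {x x₂ : ℝ} (hx : 0 < x) (hle : x ≤ x₂) (h2 : rowH e₁ e₂ 1 B C x₂ < 0) :
    rowH e₁ e₂ 1 B C x < 0 := by
  unfold rowH at h2 ⊢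
  simp only [pow_one] at h2 ⊢
  have hx2 : 0 < x₂ := hx.trans_le hle
  have e1 : ((e₁ : ℝ) + 1) * B * x ^ (e₁ + 1) + ((e₁ : ℝ) + e₂ + 2) * C * x ^ (e₁ + e₂ + 2)
      = x ^ (e₁ + 1) * (((e₁ : ℝ) + 1) * B + ((e₁ : ℝ) + e₂ + 2) * C * x ^ (e₂ + 1)) := by ring
  have e2 : ((e₁ : ℝ) + 1) * B * x₂ ^ (e₁ + 1) + ((e₁ : ℝ) + e₂ + 2) * C * x₂ ^ (e₁ + e₂ + 2)
      = x₂ ^ (e₁ + 1) * (((e₁ : ℝ) + 1) * B + ((e₁ : ℝ) + e₂ + 2) * C * x₂ ^ (e₂ + 1)) := by ring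
  rw [e2] at h2; rw [e1]
  have hneg2 : ((e₁ : ℝ) + 1) * B + ((e₁ : ℝ) + e₂ + 2) * C * x₂ ^ (e₂ + 1) < 0 :=
    (mul_neg_iff.1 h2).resolve_right (fun h => absurd (pow_pos hx2 _) (not_lt.2 h.1.le)) |>.2
  have hmono : ((e₁ : ℝ) + e₂ + 2) * C * x ^ (e₂ + 1) ≤ ((e₁ : ℝ) + e₂ + 2) * C * x₂ ^ (e₂ + 1) :=
    mul_le_mul_of_nonneg_left (pow_le_pow_left₀ hx.le hle _) (by positivity)
  exact mul_neg_of_pos_of_neg (pow_pos hx _) (by linarith)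

/-- A coherent row unswitched at `x₂` is unswitched on `(0, x₂]` (`A ≥ 0`, `B ≤ 0`: `F/x^q` is non-increasing). [this file's lemma] -/
theorem coherent_value_pos_of_le (hA : 0 ≤ A) (hB : B ≤ 0) {x x₂ : ℝ} (hx : 0 < x) (hle : x ≤ x₂)
    (h2 : 0 < A - B * x₂ ^ (e₁ + 1) - C * x₂ ^ (e₁ + e₂ + 2)) :
    0 < A - B * x ^ (e₁ + 1) - C * x ^ (e₁ + e₂ + 2) := by
  have hx2 : 0 < x₂ := hx.trans_le hle
  -- compare `F(x)·x₂^q` with `F(x₂)·x^q`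
  have hq : x ^ (e₁ + e₂ + 2) ≤ x₂ ^ (e₁ + e₂ + 2) := pow_le_pow_left₀ hx.le hle _
  have hA' : A * x ^ (e₁ + e₂ + 2) ≤ A * x₂ ^ (e₁ + e₂ + 2) := mul_le_mul_of_nonneg_left hq hA
  have hB' : -B * x₂ ^ (e₁ + 1) * x ^ (e₁ + e₂ + 2) ≤ -B * x ^ (e₁ + 1) * x₂ ^ (e₁ + e₂ + 2) := by
    have : x₂ ^ (e₁ + 1) * x ^ (e₁ + e₂ + 2) ≤ x ^ (e₁ + 1) * x₂ ^ (e₁ + e₂ + 2) := by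
      have hexp : e₁ + e₂ + 2 = (e₁ + 1) + (e₂ + 1) := by omega
      have e : x₂ ^ (e₁ + e₂ + 2) = x₂ ^ (e₁ + 1) * x₂ ^ (e₂ + 1) := by rw [hexp, pow_add]
      have e' : x ^ (e₁ + e₂ + 2) = x ^ (e₁ + 1) * x ^ (e₂ + 1) := by rw [hexp, pow_add]
      rw [e, e']
      have h1 : x ^ (e₂ + 1) ≤ x₂ ^ (e₂ + 1) := pow_le_pow_left₀ hx.le hle _
      have : 0 ≤ x₂ ^ (e₁ + 1) * x ^ (e₁ + 1) := by positivity
      nlinarith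
    have hnB : 0 ≤ -B := by linarith
    nlinarith
  have hxq : 0 < x ^ (e₁ + e₂ + 2) := pow_pos hx _
  have hx2q : 0 < x₂ ^ (e₁ + e₂ + 2) := pow_pos hx2 _
  -- `F(x) · x₂^q ≥ F(x₂) · x^q > 0`
  have key : (A - B * x₂ ^ (e₁ + 1) - C * x₂ ^ (e₁ + e₂ + 2)) * x ^ (e₁ + e₂ + 2)
      ≤ (A - B * x ^ (e₁ + 1) - C * x ^ (e₁ + e₂ + 2)) * x₂ ^ (e₁ + e₂ + 2) := by nlinarith
  have hpos : 0 < (A - B * x ^ (e₁ + 1) - C * x ^ (e₁ + e₂ + 2)) * x₂ ^ (e₁ + e₂ + 2) :=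
    lt_of_lt_of_le (mul_pos h2 hxq) key
  exact (mul_pos_iff_of_pos_right hx2q).1 hpos

/-- ★ **Coherent rising persistence.**  Unswitched coherent row (`A > 0`, `B < 0 < C`, `F > 0` on `[x₁, x₂] ⊂ (0,∞)`): rising at the right end
(`ψ₁(x₂) < 0`) ⇒ rising on the whole window.  (`M = −ψ₁/(H₁u²)` is strictly increasing on `{H₁ < 0}`.) [this file's theorem] -/
theorem coherent_rising_persist (hB : B < 0) (hC : 0 < C) {x₁ x₂ : ℝ} (h0 : 0 < x₁) (h12 : x₁ ≤ x₂)
    (hun : ∀ x ∈ Set.Icc x₁ x₂, 0 < A - B * x ^ (e₁ + 1) - C * x ^ (e₁ + e₂ + 2))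
    (hend : rowPsi1 e₁ e₂ A B C x₂ < 0) :
    ∀ x ∈ Set.Icc x₁ x₂, rowPsi1 e₁ e₂ A B C x < 0 := by
  set M : ℝ → ℝ := fun t => -rowPsi1 e₁ e₂ A B C t / (rowH e₁ e₂ 1 B C t * rowU e₁ e₂ A B C t ^ 2) with hM
  have hx0 : ∀ x ∈ Set.Icc x₁ x₂, 0 < x := fun x hx => h0.trans_le hx.1
  have hx2 : x₂ ∈ Set.Icc x₁ x₂ := ⟨h12, le_rfl⟩
  -- `H₁ < 0` at `x₂`, hence on the window
  have hH1_2 : rowH e₁ e₂ 1 B C x₂ < 0 := by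
    by_contra h; push Not at h
    exact absurd hend (not_lt.2 (coherent_rowPsi1_pos_of_rowH1_nonneg e₁ e₂ A B C (hx0 x₂ hx2) hC (hun x₂ hx2) h).le)
  have hH1neg : ∀ x ∈ Set.Icc x₁ x₂, rowH e₁ e₂ 1 B C x < 0 := fun x hx =>
    coherent_rowH1_neg_of_le e₁ e₂ B C hC.le (hx0 x hx) hx.2 hH1_2
  have hu_pos : ∀ x ∈ Set.Icc x₁ x₂, 0 < rowU e₁ e₂ A B C x := fun x hx => rowU_pos e₁ e₂ A B C (hun x hx)
  -- derivative of `M`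
  have hderiv : ∀ x ∈ Set.Icc x₁ x₂, ∃ D : ℝ, 0 < D ∧ HasDerivAt M D x := by
    intro x hx
    have hx' := hx0 x hx
    have hFne := (hun x hx).ne'
    have hψ := hasDerivAt_rowPsi1 e₁ e₂ A B C hx'.ne' hFne
    have hH1 : HasDerivAt (fun t => rowH e₁ e₂ 1 B C t) (rowH e₁ e₂ 2 B C x / x) x := by
      have h := hasDerivAt_Hk e₁ e₂ (((e₁ : ℝ) + 1) * B) (((e₁ : ℝ) + e₂ + 2) * C) hx'.ne'
      refine (h.congr_of_eventuallyEq (Filter.Eventually.of_forall fun t => ?_)).congr_deriv ?_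
      · simp only [rowH, pow_one]
      · simp only [rowH]; ring
    have hu : HasDerivAt (fun t => rowU e₁ e₂ A B C t) (rowH e₁ e₂ 1 B C x / x * rowU e₁ e₂ A B C x ^ 2) x := by
      have h := hasDerivAt_uInv e₁ e₂ A B C hx'.ne' hFne
      refine (h.congr_of_eventuallyEq (Filter.Eventually.of_forall fun t => ?_)).congr_deriv ?_
      · simp only [rowU]
      · simp only [rowH, rowU, pow_one]
    have hden := hH1.mul (hu.pow 2)
    have hden_ne : rowH e₁ e₂ 1 B C x * rowU e₁ e₂ A B C x ^ 2 ≠ 0 :=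
      mul_ne_zero (hH1neg x hx).ne (pow_ne_zero 2 (hu_pos x hx).ne')
    have hMd := (hψ.neg.div hden hden_ne)
    have hkey := rowH1_mul_rowPsi2 e₁ e₂ A B C x
    have hψ1 := rowPsi1_eq_mul e₁ e₂ A B C x
    have hdet : rowH e₁ e₂ 1 B C x * rowH e₁ e₂ 3 B C x - rowH e₁ e₂ 2 B C x ^ 2 < 0 := by
      rw [rowH_det13]
      have hβ : B * x ^ (e₁ + 1) < 0 := mul_neg_of_neg_of_pos hB (pow_pos hx' _)
      have hγ : 0 < C * x ^ (e₁ + e₂ + 2) := by positivity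
      have hc : 0 < ((e₁ : ℝ) + 1) * ((e₁ : ℝ) + e₂ + 2) * ((e₂ : ℝ) + 1) ^ 2 := by positivity
      exact mul_neg_of_neg_of_pos (mul_neg_of_neg_of_pos hβ hγ) hc
    have hH1x := hH1neg x hx
    have hux := hu_pos x hx
    refine ⟨-(rowH e₁ e₂ 1 B C x * rowH e₁ e₂ 3 B C x - rowH e₁ e₂ 2 B C x ^ 2)
        / (rowH e₁ e₂ 1 B C x ^ 2 * rowU e₁ e₂ A B C x * x), by
      have : 0 < -(rowH e₁ e₂ 1 B C x * rowH e₁ e₂ 3 B C x - rowH e₁ e₂ 2 B C x ^ 2) := neg_pos.2 hdet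
      have : 0 < rowH e₁ e₂ 1 B C x ^ 2 := sq_pos_iff.mpr hH1x.ne
      positivity, ?_⟩
    refine hMd.congr_deriv ?_
    have hune : rowU e₁ e₂ A B C x ≠ 0 := hux.ne'
    have hH1ne : rowH e₁ e₂ 1 B C x ≠ 0 := hH1x.ne
    have hxne : x ≠ 0 := hx'.ne'
    have e2 : rowPsi2 e₁ e₂ A B C x
        = (rowU e₁ e₂ A B C x * (rowH e₁ e₂ 1 B C x * rowH e₁ e₂ 3 B C x - rowH e₁ e₂ 2 B C x ^ 2)
          + rowU e₁ e₂ A B C x * (rowH e₁ e₂ 2 B C x + rowH e₁ e₂ 1 B C x ^ 2 * rowU e₁ e₂ A B C x)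
            * (rowH e₁ e₂ 2 B C x + 2 * rowH e₁ e₂ 1 B C x ^ 2 * rowU e₁ e₂ A B C x)) / rowH e₁ e₂ 1 B C x := by
      rw [← hkey]; field_simp
    simp only [Pi.mul_apply, Pi.pow_apply, Pi.neg_apply]
    rw [e2, hψ1]
    field_simp
    ring
  have hcont : ContinuousOn M (Set.Icc x₁ x₂) := fun x hx => by
    obtain ⟨D, _, hD⟩ := hderiv x hx; exact hD.continuousAt.continuousWithinAt
  have hmono : StrictMonoOn M (Set.Icc x₁ x₂) := by
    refine strictMonoOn_of_deriv_pos (convex_Icc x₁ x₂) hcont fun x hx => ?_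
    rw [interior_Icc] at hx
    obtain ⟨D, hDpos, hD⟩ := hderiv x ⟨hx.1.le, hx.2.le⟩
    rw [hD.deriv]; exact hDpos
  -- `M(x₂) < 0`, so `M < 0` on the window, i.e. `ψ₁ < 0` there (`H₁ < 0`)
  have hM2 : M x₂ < 0 := by
    simp only [hM]
    have hden : rowH e₁ e₂ 1 B C x₂ * rowU e₁ e₂ A B C x₂ ^ 2 < 0 :=
      mul_neg_of_neg_of_pos hH1_2 (pow_pos (hu_pos x₂ hx2) 2)
    exact div_neg_of_pos_of_neg (neg_pos.2 hend) hden
  intro x hx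
  have hMx : M x < 0 := by
    rcases eq_or_lt_of_le hx.2 with h | h
    · rw [h]; exact hM2
    · exact (hmono hx hx2 h).trans hM2
  simp only [hM] at hMx
  have hden : rowH e₁ e₂ 1 B C x * rowU e₁ e₂ A B C x ^ 2 < 0 :=
    mul_neg_of_neg_of_pos (hH1neg x hx) (pow_pos (hu_pos x hx) 2)
  have := (div_neg_iff.1 hMx)
  rcases this with ⟨hnum, _⟩ | ⟨_, hden'⟩
  · linarith
  · exact absurd hden (not_lt.2 hden'.le)

end Row

/-! ### §2 The coherent cell in the line's currency -/

/-- ★★ **ONE RISING COHERENT ROW AGAINST ANY INCOHERENT CLOUD: the company's log-Wronskian has NO THREE ZEROS on the window** (LINE currency, K = 3).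
Support `d 0 < d 1 < d 2`; coherent row `j₀` (`a_{j₀0} > 0`, `a_{j₀1} > 0`, `a_{j₀2} < 0`); every other row an incoherent puller (`a_{j0} > 0`, `a_{j1} ≤ 0`,
`a_{j2} ≤ 0`, `a_{j1} + a_{j2} < 0`).  On `[x₁, x₃] ⊂ (0,∞)` with EVERY row unswitched at `x₃` and the coherent row still rising at `x₃`
(`rowPsi1 e₁ e₂ a_{j₀0} (−a_{j₀1}) (−a_{j₀2}) x₃ < 0`, `d 1 = d 0 + e₁ + 1`, `d 2 = d 1 + e₂ + 1`), `W(∏_j f_j)` does not vanish at `x₁ < x₂ < x₃`.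
[this file's theorem] -/
theorem oneCoherent_trinomialCloud_wronskian_no_three_zeros {m : ℕ} (d : Fin 3 → ℕ) (e₁ e₂ : ℕ)
    (he₁ : d 1 = d 0 + e₁ + 1) (he₂ : d 2 = d 1 + e₂ + 1)
    (a : Fin m → Fin 3 → ℝ) (j₀ : Fin m) (hr0 : 0 < a j₀ 0) (hr1 : 0 < a j₀ 1) (hr2 : a j₀ 2 < 0)
    (hpul : ∀ j, j ≠ j₀ → 0 < a j 0 ∧ a j 1 ≤ 0 ∧ a j 2 ≤ 0 ∧ a j 1 + a j 2 < 0)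
    {x₁ x₂ x₃ : ℝ} (h0 : 0 < x₁) (h12' : x₁ < x₂) (h23 : x₂ < x₃)
    (hun : ∀ j, 0 < (∑ l, C (a j l) * X ^ (d l) : ℝ[X]).eval x₃)
    (hrise : rowPsi1 e₁ e₂ (a j₀ 0) (-(a j₀ 1)) (-(a j₀ 2)) x₃ < 0)
    (hzero : ∀ x ∈ ({x₁, x₂, x₃} : Set ℝ),
      ((∏ j, ∑ l, C (a j l) * X ^ (d l) : ℝ[X]) * (X * derivative (X * derivative (∏ j, ∑ l, C (a j l) * X ^ (d l) : ℝ[X])))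
        - (X * derivative (∏ j, ∑ l, C (a j l) * X ^ (d l) : ℝ[X])) ^ 2).eval x = 0) : False := by
  classical
  have hd := fin3_support_eq_gaps d e₁ e₂ he₁ he₂
  have hev : ∀ j x, (∑ l, C (a j l) * X ^ (d l) : ℝ[X]).eval x
        = x ^ (d 0) * (a j 0 - (-(a j 1)) * x ^ (e₁ + 1) - (-(a j 2)) * x ^ (e₁ + e₂ + 2)) := by
    intro j x
    have h := (eval_trinomial_three (d 0) (e₁ + 1) (e₁ + e₂ + 2) (a j) x).1
    rw [hd] at h; rw [h]; ring
  have h13 : x₁ < x₃ := h12'.trans h23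
  have hIcc : ∀ x ∈ ({x₁, x₂, x₃} : Set ℝ), x ∈ Set.Icc x₁ x₃ := by
    intro x hx
    simp only [Set.mem_insert_iff, Set.mem_singleton_iff] at hx
    rcases hx with h | h | h <;> (subst h; constructor <;> linarith)
  have hx3 : 0 < x₃ := h0.trans h13
  -- normal-form values at `x₃`, then on the whole window (antitone bookkeeping)
  have hnf3 : ∀ j, 0 < a j 0 - (-(a j 1)) * x₃ ^ (e₁ + 1) - (-(a j 2)) * x₃ ^ (e₁ + e₂ + 2) := by
    intro j
    have h := hun j
    rw [hev] at h
    exact (mul_pos_iff_of_pos_left (pow_pos hx3 _)).1 h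
  have hnf : ∀ x ∈ Set.Icc x₁ x₃, ∀ j, 0 < a j 0 - (-(a j 1)) * x ^ (e₁ + 1) - (-(a j 2)) * x ^ (e₁ + e₂ + 2) := by
    intro x hx j
    have hx0 : 0 < x := h0.trans_le hx.1
    by_cases hj : j = j₀
    · subst hj
      exact coherent_value_pos_of_le e₁ e₂ (a j 0) (-(a j 1)) (-(a j 2)) hr0.le (by linarith) hx0 hx.2 (hnf3 j)
    · obtain ⟨_, h1, h2, _⟩ := hpul j hj
      have h3 := hnf3 j
      have hm1 : a j 1 * x₃ ^ (e₁ + 1) ≤ a j 1 * x ^ (e₁ + 1) :=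
        mul_le_mul_of_nonpos_left (pow_le_pow_left₀ hx0.le hx.2 _) h1
      have hm2 : a j 2 * x₃ ^ (e₁ + e₂ + 2) ≤ a j 2 * x ^ (e₁ + e₂ + 2) :=
        mul_le_mul_of_nonpos_left (pow_le_pow_left₀ hx0.le hx.2 _) h2
      linarith
  have hf : ∀ x ∈ Set.Icc x₁ x₃, ∀ j, (∑ l, C (a j l) * X ^ (d l) : ℝ[X]).eval x ≠ 0 := by
    intro x hx j
    rw [hev]
    exact mul_ne_zero (pow_ne_zero _ (h0.trans_le hx.1).ne') (hnf x hx j).ne'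
  -- the sum of the slope forms vanishes at the three points
  have hzero' : ∀ x ∈ ({x₁, x₂, x₃} : Set ℝ),
      rowPsi1 e₁ e₂ (a j₀ 0) (-(a j₀ 1)) (-(a j₀ 2)) x
        + cloudP1 e₁ e₂ (Finset.univ.erase j₀) (fun _ => (1 : ℝ)) (fun j => a j 0) (fun j => -(a j 1)) (fun j => -(a j 2)) x = 0 := by
    intro x hx
    have hxI := hIcc x hx
    have hx0 : 0 < x := h0.trans_le hxI.1
    have h := hzero x hx
    rw [logWronskian_prod_eq_rowPsi1_sum d e₁ e₂ he₁ he₂ a hx0 (hf x hxI)] at h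
    have hP : ((∏ j, (∑ l, C (a j l) * X ^ (d l) : ℝ[X])).eval x) ≠ 0 := by
      rw [eval_prod]; exact Finset.prod_ne_zero_iff.2 fun j _ => hf x hxI j
    have hS : ∑ j, rowPsi1 e₁ e₂ (a j 0) (-(a j 1)) (-(a j 2)) x = 0 := by
      rcases mul_eq_zero.1 h with h1 | h1
      · exact absurd (neg_eq_zero.1 h1) (pow_ne_zero 2 hP)
      · exact h1
    rw [← Finset.add_sum_erase _ _ (Finset.mem_univ j₀)] at hS
    unfold cloudP1
    simpa only [one_mul] using hS
  -- the coherent row rises on the whole window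
  have hpost := coherent_rising_persist e₁ e₂ (a j₀ 0) (-(a j₀ 1)) (-(a j₀ 2)) (by linarith) (by linarith) h0 h13.le
    (fun x hx => hnf x hx j₀) hrise
  rcases (Finset.univ.erase j₀).eq_empty_or_nonempty with hs | hs
  · -- no pullers: `ψ₁ = 0` at `x₁` contradicts rising
    have h1 := hzero' x₁ (by simp)
    rw [hs] at h1
    simp only [cloudP1, Finset.sum_empty, add_zero] at h1
    exact absurd h1 (hpost x₁ ⟨le_rfl, h13.le⟩).ne
  · exact oneCoherent_slope_no_three_zeros e₁ e₂ (a := a j₀ 0) (b := -(a j₀ 1)) (c := -(a j₀ 2)) hr0 (by linarith) (by linarith)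
      (Finset.univ.erase j₀) hs (fun _ => (1 : ℝ)) (fun j => a j 0) (fun j => -(a j 1)) (fun j => -(a j 2))
      (fun _ _ => one_pos) (fun j hj => by have := (hpul j (Finset.ne_of_mem_erase hj)).2.1; linarith)
      (fun j hj => by have := (hpul j (Finset.ne_of_mem_erase hj)).2.2.1; linarith)
      (fun j hj => by have := (hpul j (Finset.ne_of_mem_erase hj)).2.2.2; linarith)
      h0 h12' h23 (fun x hx => hnf x hx j₀) hpost (fun x hx j hj => hnf x hx j) hzero'

/-- ★ **The coherent cell carries at most TWO zeros of the company's log-Wronskian** (window `(u, v)`, hypotheses at `v`). [this file's theorem] -/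
theorem oneCoherent_trinomialCloud_wronskian_roots_le_two {m : ℕ} (d : Fin 3 → ℕ) (e₁ e₂ : ℕ)
    (he₁ : d 1 = d 0 + e₁ + 1) (he₂ : d 2 = d 1 + e₂ + 1)
    (a : Fin m → Fin 3 → ℝ) (j₀ : Fin m) (hr0 : 0 < a j₀ 0) (hr1 : 0 < a j₀ 1) (hr2 : a j₀ 2 < 0)
    (hpul : ∀ j, j ≠ j₀ → 0 < a j 0 ∧ a j 1 ≤ 0 ∧ a j 2 ≤ 0 ∧ a j 1 + a j 2 < 0)
    {u v : ℝ} (hu : 0 < u)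
    (hun : ∀ j, 0 < (∑ l, C (a j l) * X ^ (d l) : ℝ[X]).eval v)
    (hrise : rowPsi1 e₁ e₂ (a j₀ 0) (-(a j₀ 1)) (-(a j₀ 2)) v < 0) :
    (((∏ j, ∑ l, C (a j l) * X ^ (d l) : ℝ[X]) * (X * derivative (X * derivative (∏ j, ∑ l, C (a j l) * X ^ (d l) : ℝ[X])))
        - (X * derivative (∏ j, ∑ l, C (a j l) * X ^ (d l) : ℝ[X])) ^ 2).roots.toFinset.filter (fun w => u < w ∧ w < v)).card ≤ 2 := by
  classical
  set W : ℝ[X] := (∏ j, ∑ l, C (a j l) * X ^ (d l) : ℝ[X]) * (X * derivative (X * derivative (∏ j, ∑ l, C (a j l) * X ^ (d l) : ℝ[X])))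
      - (X * derivative (∏ j, ∑ l, C (a j l) * X ^ (d l) : ℝ[X])) ^ 2 with hWdef
  by_contra hgt
  push Not at hgt
  obtain ⟨y₁, hy₁, y₂, hy₂, y₃, hy₃, h12', h23⟩ := exists_three_lt_of_card (T := W.roots.toFinset.filter (fun w => u < w ∧ w < v)) hgt
  by_cases hW0 : W = 0
  · rw [hW0, roots_zero, Multiset.toFinset_zero, Finset.filter_empty] at hy₁; exact absurd hy₁ (Finset.notMem_empty _)
  rw [mem_filter, Multiset.mem_toFinset, mem_roots hW0] at hy₁ hy₂ hy₃
  have hd := fin3_support_eq_gaps d e₁ e₂ he₁ he₂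
  have hev : ∀ j x, (∑ l, C (a j l) * X ^ (d l) : ℝ[X]).eval x
        = x ^ (d 0) * (a j 0 - (-(a j 1)) * x ^ (e₁ + 1) - (-(a j 2)) * x ^ (e₁ + e₂ + 2)) := by
    intro j x
    have h := (eval_trinomial_three (d 0) (e₁ + 1) (e₁ + e₂ + 2) (a j) x).1
    rw [hd] at h; rw [h]; ring
  have hv0 : 0 < v := hu.trans (hy₃.2.1.trans hy₃.2.2)
  have hy30 : 0 < y₃ := hu.trans hy₃.2.1
  have hnfv : ∀ j, 0 < a j 0 - (-(a j 1)) * v ^ (e₁ + 1) - (-(a j 2)) * v ^ (e₁ + e₂ + 2) := fun j => by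
    have h := hun j; rw [hev] at h; exact (mul_pos_iff_of_pos_left (pow_pos hv0 _)).1 h
  -- transport the hypotheses from `v` to `y₃ ≤ v`
  have hnf3 : ∀ x ∈ Set.Icc y₃ v, ∀ j, 0 < a j 0 - (-(a j 1)) * x ^ (e₁ + 1) - (-(a j 2)) * x ^ (e₁ + e₂ + 2) := by
    intro x hx j
    have hx0 : 0 < x := hy30.trans_le hx.1
    by_cases hj : j = j₀
    · subst hj
      exact coherent_value_pos_of_le e₁ e₂ (a j 0) (-(a j 1)) (-(a j 2)) hr0.le (by linarith) hx0 hx.2 (hnfv j)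
    · obtain ⟨_, h1, h2, _⟩ := hpul j hj
      have h3 := hnfv j
      have hm1 : a j 1 * v ^ (e₁ + 1) ≤ a j 1 * x ^ (e₁ + 1) :=
        mul_le_mul_of_nonpos_left (pow_le_pow_left₀ hx0.le hx.2 _) h1
      have hm2 : a j 2 * v ^ (e₁ + e₂ + 2) ≤ a j 2 * x ^ (e₁ + e₂ + 2) :=
        mul_le_mul_of_nonpos_left (pow_le_pow_left₀ hx0.le hx.2 _) h2
      linarith
  have hun3 : ∀ j, 0 < (∑ l, C (a j l) * X ^ (d l) : ℝ[X]).eval y₃ := fun j => by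
    rw [hev]; exact mul_pos (pow_pos hy30 _) (hnf3 y₃ ⟨le_rfl, hy₃.2.2.le⟩ j)
  have hrise3 : rowPsi1 e₁ e₂ (a j₀ 0) (-(a j₀ 1)) (-(a j₀ 2)) y₃ < 0 :=
    coherent_rising_persist e₁ e₂ (a j₀ 0) (-(a j₀ 1)) (-(a j₀ 2)) (by linarith) (by linarith) hy30 hy₃.2.2.le
      (fun x hx => hnf3 x hx j₀) hrise y₃ ⟨le_rfl, hy₃.2.2.le⟩
  refine oneCoherent_trinomialCloud_wronskian_no_three_zeros d e₁ e₂ he₁ he₂ a j₀ hr0 hr1 hr2 hpul (hu.trans hy₁.2.1) h12' h23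
    hun3 hrise3 ?_
  intro x hx
  simp only [Set.mem_insert_iff, Set.mem_singleton_iff] at hx
  rcases hx with h | h | h <;> subst h
  · exact hy₁.1
  · exact hy₂.1
  · exact hy₃.1

/-- ★★ **Hence AT MOST THREE zeros of `eulerNumerator d a l₀` on the window, for EVERY coupling `l₀`.** [this file's theorem] -/
theorem oneCoherent_trinomialCloud_eulerNumerator_roots_le_three {m : ℕ} (d : Fin 3 → ℕ) (e₁ e₂ : ℕ)
    (he₁ : d 1 = d 0 + e₁ + 1) (he₂ : d 2 = d 1 + e₂ + 1)
    (a : Fin m → Fin 3 → ℝ) (j₀ : Fin m) (hr0 : 0 < a j₀ 0) (hr1 : 0 < a j₀ 1) (hr2 : a j₀ 2 < 0)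
    (hpul : ∀ j, j ≠ j₀ → 0 < a j 0 ∧ a j 1 ≤ 0 ∧ a j 2 ≤ 0 ∧ a j 1 + a j 2 < 0)
    (l₀ : Fin 3) {u v : ℝ} (hu : 0 < u) (huv : u ≤ v)
    (hun : ∀ j, 0 < (∑ l, C (a j l) * X ^ (d l) : ℝ[X]).eval v)
    (hrise : rowPsi1 e₁ e₂ (a j₀ 0) (-(a j₀ 1)) (-(a j₀ 2)) v < 0) :
    ((∑ j, (∑ l, C (a j l * ((d l : ℝ) - d l₀)) * X ^ (d l)) * ∏ i ∈ Finset.univ.erase j, (∑ l, C (a i l) * X ^ (d l))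
        : ℝ[X]).roots.toFinset.filter (fun t => u ≤ t ∧ t ≤ v)).card ≤ 3 := by
  classical
  have hd := fin3_support_eq_gaps d e₁ e₂ he₁ he₂
  have hev : ∀ j x, (∑ l, C (a j l) * X ^ (d l) : ℝ[X]).eval x
        = x ^ (d 0) * (a j 0 - (-(a j 1)) * x ^ (e₁ + 1) - (-(a j 2)) * x ^ (e₁ + e₂ + 2)) := by
    intro j x
    have h := (eval_trinomial_three (d 0) (e₁ + 1) (e₁ + e₂ + 2) (a j) x).1
    rw [hd] at h; rw [h]; ring
  have hv0 : 0 < v := hu.trans_le huv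
  have hnfv : ∀ j, 0 < a j 0 - (-(a j 1)) * v ^ (e₁ + 1) - (-(a j 2)) * v ^ (e₁ + e₂ + 2) := fun j => by
    have h := hun j; rw [hev] at h; exact (mul_pos_iff_of_pos_left (pow_pos hv0 _)).1 h
  have hP : ∀ t ∈ Set.Icc u v, (∏ j, (∑ l, C (a j l) * X ^ (d l) : ℝ[X])).eval t ≠ 0 := by
    intro t ht
    have ht0 : 0 < t := hu.trans_le ht.1
    rw [eval_prod]
    refine Finset.prod_ne_zero_iff.2 fun j _ => ?_
    rw [hev]
    refine mul_ne_zero (pow_ne_zero _ ht0.ne') (ne_of_gt ?_)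
    by_cases hj : j = j₀
    · subst hj
      exact coherent_value_pos_of_le e₁ e₂ (a j 0) (-(a j 1)) (-(a j 2)) hr0.le (by linarith) ht0 ht.2 (hnfv j)
    · obtain ⟨_, h1, h2, _⟩ := hpul j hj
      have h3 := hnfv j
      have hm1 : a j 1 * v ^ (e₁ + 1) ≤ a j 1 * t ^ (e₁ + 1) :=
        mul_le_mul_of_nonpos_left (pow_le_pow_left₀ ht0.le ht.2 _) h1
      have hm2 : a j 2 * v ^ (e₁ + e₂ + 2) ≤ a j 2 * t ^ (e₁ + e₂ + 2) :=
        mul_le_mul_of_nonpos_left (pow_le_pow_left₀ ht0.le ht.2 _) h2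
      linarith
  have h1 := eulerNumerator_roots_Icc_le_wronskian_roots_add_one d a l₀ hu hP
  have h2 := oneCoherent_trinomialCloud_wronskian_roots_le_two d e₁ e₂ he₁ he₂ a j₀ hr0 hr1 hr2 hpul hu hun hrise
  omega

end ProductPlusOne

end Summit.ValiantsHypothesis.ValiantsHypothesis.Theorems.LacunarySymmetroidMatrixDescartes
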